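import Literature.Computability.QuantumComplexity.UniformSubstitution
import Literature.Computability.QuantumComplexity.Lemma24Realify
import HarnessLib

/-!
# Realification of quantum circuits: one extra wire makes every gate set real

The standard removal of complex amplitudes (Adleman–DeMarrais–Huang, *Quantum computability*, SIAM
J. Comput. 26 (1997), §2, p. 1525: "According to [BV], one can assume without loss of generality that
the amplitudes of `δ` are all real"; Bernstein–Vazirani 1997, §8 — a complex amplitude `a + ib` is
replaced by the real `2 × 2` block `[[a, -b], [b, a]]` acting on one extra bit recording "real part /
imaginary part"; in the circuit model: Aharonov 2003 / Shi 2003, "rebits"), carried out for the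
tree's uniform circuit families (`Cryptography/QuantumCircuit.lean`, `ClassBQP.lean`):

* The matrix algebra is REUSED from `Lemma24Realify.lean` (Aaronson–Ambainis Lemma 24 over the sign
  basis needed the same reduction): `Lemma24.reOp M = [[Re M, -Im M], [Im M, Re M]]` on `n + 1` qubits
  (the LAST wire is the real/imaginary flag), `Lemma24.reVec ψ = (Re ψ ; Im ψ)`, multiplicativity,
  `reOp_mulVec_reVec`, `reVec_basisState`, placement (`reOp_placeGate` along `liftEmb`, and
  `reOp_placeGate_of_isRealMatrix` for real gates), Born weights (`sum_ite_norm_sq_reVec`). Added here: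
  `reOp` commutes with the conjugate transpose and preserves unitarity (`reOp_mem_unitaryGroup`), its
  entries are `Re`, `Im`, `-Im` of entries of `M` (`reOp_apply_mem`), and the scratch-wire placement
  `extEmb e` of `BQPGateSetIndependence.lean` IS `liftEmb e` (`extEmb_eq_liftEmb`).
* `realifyGateSet G` — same symbols, arity `+ 1`, matrices `reOp (G.mat g)`; unitary if `G` is.
* The realified family is gate-by-gate SUBSTITUTION (`substFamily` of `BQPGateSetIndependence.lean`)
  along the compiler `realifyCompiler G` (scratch block of ONE wire shared by all gates; the word
  of `g` is the single gate `g` of `realifyGateSet G` on its wires plus the scratch wire), so that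
  polynomial-time uniformity is inherited for free from the uniform-substitution transducer
  (`GateCompiler.isUniform_substFamily`, `UniformSubstitution.lean`; the words are constant, hence
  trivially polynomial-time); placement commutes with realification, so the substituted circuit acts
  on realified states as the realification of the original circuit
  (`toMatrix_substCircuit_mulVec_reVec`), and since the
  input `|x 0ᵐ 0⟩` is real and `|Re|² + |Im|² = |·|²`, **acceptance probabilities are unchanged**
  (`acceptProbOn_realifyFamily`).
* **`BQPWith_subset_BQPWith_realify`**: `BQPWith G ε ⊆ BQPWith (realifyGateSet G) ε` for every finite
  gate set all of whose gates act on at least one wire (a `0`-ary gate is a global phase, invisible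
  before but visible after realification on the empty register), in particular
  `BQPOver G ⊆ BQPOver (realifyGateSet G)`.

Used by the Adleman–DeMarrais–Huang route to `BQPQTMWith adhAmplitudes = BQPQTM`
(`QuantumTuringADHGateSet.lean`): the universal gate set `{R_θ, R_θ⁻¹, P_θ, P_θ⁻¹, CNOT}` has
entries `(3 ± 4i)/5`, and its realification has entries in `{0, ±1, ±3/5, ±4/5}` only.
Everything is proved; no named facts are introduced.

## References

* L. M. Adleman, J. DeMarrais, M.-D. A. Huang, *Quantum computability*, SIAM J. Comput. 26 (1997)
  1524–1540 [AdlemanDeMarraisHuangSICOMP1997], §2 (p. 1525: real amplitudes suffice, after [BV]).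
* E. Bernstein, U. Vazirani, *Quantum complexity theory*, SIAM J. Comput. 26 (1997) 1411–1473
  [BernsteinVazirani1997], §8.
* M. A. Nielsen, I. L. Chuang, *Quantum Computation and Quantum Information*, CUP 2010, §4.5
  [NielsenChuang2010].
* S. Arora, B. Barak, *Computational Complexity: A Modern Approach*, CUP 2009, §10.3.8 (uniform
  substitution) [AroraBarak2009].
-/

noncomputable section

namespace Literature.Computability.QuantumComplexity

open _root_.Computability Complexity Cryptography Matrix Complex Lemma24

/-! ### Complements on `Lemma24.reOp` -/

section ReOp

variable {N k : ℕ}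

/-- **Realification commutes with the conjugate transpose** (its entries are real). [folklore] -/
theorem conjTranspose_reOp (M : Matrix (QReg N) (QReg N) ℂ) : (reOp M)ᴴ = reOp Mᴴ := by
  refine matrix_ext_snoc fun x' y' r s => ?_
  rw [Matrix.conjTranspose_apply, reOp_snoc, reOp_snoc, Matrix.conjTranspose_apply, Complex.star_def]
  cases r <;> cases s <;> simp [blockEntry, Complex.conj_ofReal]

/-- **Realification preserves unitarity** (`reOp U (reOp U)ᴴ = reOp (U Uᴴ) = 1`). [cite: BernsteinVazirani1997, §8] -/
theorem reOp_mem_unitaryGroup {U : Matrix (QReg N) (QReg N) ℂ} (hU : U ∈ Matrix.unitaryGroup (QReg N) ℂ) :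
    reOp U ∈ Matrix.unitaryGroup (QReg (N + 1)) ℂ := by
  rw [Matrix.mem_unitaryGroup_iff, Matrix.star_eq_conjTranspose] at hU ⊢
  rw [conjTranspose_reOp, ← reOp_mul, hU, reOp_one]

/-- The possible entries of a realification: real parts, imaginary parts and their negatives of the
entries of the matrix. [folklore] -/
theorem reOp_apply_mem (M : Matrix (QReg N) (QReg N) ℂ) (x z : QReg (N + 1)) :
    reOp M x z = (((M (Fin.init x) (Fin.init z)).re : ℝ) : ℂ) ∨
      reOp M x z = (((M (Fin.init x) (Fin.init z)).im : ℝ) : ℂ) ∨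
      reOp M x z = -(((M (Fin.init x) (Fin.init z)).im : ℝ) : ℂ) := by
  rw [← snoc_init_last x, ← snoc_init_last z, reOp_snoc]
  simp only [Fin.init_snoc]
  cases x (Fin.last N) <;> cases z (Fin.last N) <;> simp [blockEntry]

/-- Gate wires: the scratch-block placement of `BQPGateSetIndependence.lean` (one scratch wire) sends
`castSucc j` to `castSucc (e j)`. [folklore] -/
theorem extEmb_castSucc (e : Fin k ↪ Fin N) (j : Fin k) :
    extEmb e (le_refl 1) (Fin.castSucc j) = Fin.castSucc (e j) :=
  extEmb_castAdd e _ j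

/-- The scratch wire: the extended placement sends the last wire to the last wire. [folklore] -/
theorem extEmb_last (e : Fin k ↪ Fin N) : extEmb e (le_refl 1) (Fin.last k) = Fin.last N := by
  have h1 : Fin.last k = Fin.natAdd k (0 : Fin 1) := Fin.ext (by simp)
  have h2 : Fin.natAdd N (Fin.castLE (le_refl 1) (0 : Fin 1)) = Fin.last N := Fin.ext (by simp)
  rw [h1, extEmb_natAdd, h2]

/-- **With one scratch wire, the placement `extEmb e` of a substituted word is the lifted embedding
`liftEmb e` of the realification** (`Lemma24Realify.lean`). [folklore] -/
theorem extEmb_eq_liftEmb (e : Fin k ↪ Fin N) : extEmb e (le_refl 1) = liftEmb e := by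
  ext j : 1
  induction j using Fin.lastCases with
  | last => rw [extEmb_last, liftEmb_last]
  | cast j => rw [extEmb_castSucc, liftEmb_castSucc]

end ReOp

/-! ### The realified gate set and the realification compiler -/

section GateSet

variable (G : QGateSet)

/-- **The realified gate set**: the same symbols, each acting on one more wire (the real/imaginary
flag, last), with the realified matrices. [cite: AdlemanDeMarraisHuangSICOMP1997, §2 (p. 1525)] -/
def realifyGateSet : QGateSet where
  Op := G.Op
  arity g := G.arity g + 1
  mat g := reOp (G.mat g)

/-- The symbols of the realified gate set are those of `G` (encodable when they are). [folklore] -/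
instance instEncodableOpRealifyGateSet [Encodable G.Op] : Encodable (realifyGateSet G).Op :=
  inferInstanceAs (Encodable G.Op)

/-- The symbols of the realified gate set are those of `G` (finite when they are). [folklore] -/
instance instFiniteOpRealifyGateSet [Finite G.Op] : Finite (realifyGateSet G).Op :=
  inferInstanceAs (Finite G.Op)

variable {G}

/-- The realified gate set is unitary when `G` is. [cite: AdlemanDeMarraisHuangSICOMP1997, §2 (p. 1525)] -/
theorem realifyGateSet_isUnitary (hG : G.IsUnitary) : (realifyGateSet G).IsUnitary :=
  fun g => reOp_mem_unitaryGroup (hG g)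

/-- Entries of the realified gates: real parts, imaginary parts, negated imaginary parts of entries
of the gates of `G`. [folklore] -/
theorem realifyGateSet_mat_apply (g : G.Op) (x z : QReg (G.arity g + 1)) :
    (realifyGateSet G).mat g x z = (((G.mat g (Fin.init x) (Fin.init z)).re : ℝ) : ℂ) ∨
      (realifyGateSet G).mat g x z = (((G.mat g (Fin.init x) (Fin.init z)).im : ℝ) : ℂ) ∨
      (realifyGateSet G).mat g x z = -(((G.mat g (Fin.init x) (Fin.init z)).im : ℝ) : ℂ) :=
  reOp_apply_mem _ _ _

variable (G)

/-- **The realification compiler**: one shared scratch wire (the flag), and the word of `g` is the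
single realified gate `g` on its wires followed by the flag wire (accuracy levels are irrelevant:
the implementation is exact on realified states). [cite: AdlemanDeMarraisHuangSICOMP1997, §2 (p. 1525)] -/
def realifyCompiler : GateCompiler G (realifyGateSet G) where
  scratch := 1
  extra _ := 1
  extra_le _ := le_rfl
  word _ g := ⟨[QGate.gate (G := realifyGateSet G) g (Function.Embedding.refl (Fin (G.arity g + 1)))]⟩

/-- The words of the realification compiler are oracle-free. [folklore] -/
theorem realifyCompiler_isOracleFree (k : ℕ) (g : G.Op) : ((realifyCompiler G).word k g).IsOracleFree := by
  intro γ hγ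
  obtain rfl : γ = QGate.gate (G := realifyGateSet G) g (Function.Embedding.refl _) := List.mem_singleton.1 hγ
  trivial

/-- The realification compiler is polynomial-time (its words do not depend on the accuracy level).
[folklore] -/
theorem realifyCompiler_polyTime [Encodable G.Op] : (realifyCompiler G).PolyTime :=
  ⟨fun g => (CodeFP.const unaryEncodeNat ((realifyCompiler G).word 0 g)).polyTimeComputable⟩

end GateSet

/-! ### Semantics: the realified circuit acts on realified states as the original circuit -/

section Semantics

variable {G : QGateSet} {N : ℕ}

/-- **One substituted gate** acts on realified states as the realification of the original gate
(gate symbols by `reOp_placeGate`; oracle gates are real and are carried along,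
`reOp_placeGate_of_isRealMatrix`). [cite: BernsteinVazirani1997, §8] -/
theorem toMatrix_substGate_mulVec_reVec (A : Language Bool) (k : ℕ) (γ : QGate G N) (ψ : QReg N → ℂ) :
    (⟨substGate (realifyCompiler G) k γ⟩ : QCircuit (realifyGateSet G) (N + (realifyCompiler G).scratch)).toMatrix A *ᵥ
        reVec ψ = reVec (γ.toMatrix A *ᵥ ψ) := by
  cases γ with
  | gate g e =>
    have hγ : substGate (realifyCompiler G) k (QGate.gate g e) =
        [QGate.gate (G := realifyGateSet G) g
          ((Function.Embedding.refl _).trans (extEmb e ((realifyCompiler G).extra_le g)))] := rfl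
    have htr : (Function.Embedding.refl (Fin (G.arity g + 1))).trans (extEmb e (le_refl 1)) = extEmb e (le_refl 1) := by
      ext; rfl
    rw [hγ, QCircuit.toMatrix_cons, QCircuit.toMatrix_nil, Matrix.one_mul]
    change placeGate ((Function.Embedding.refl (Fin (G.arity g + 1))).trans (extEmb e (le_refl 1)))
        (reOp (G.mat g)) *ᵥ reVec ψ = reVec (placeGate e (G.mat g) *ᵥ ψ)
    rw [htr, extEmb_eq_liftEmb, ← reOp_placeGate, reOp_mulVec_reVec]
  | oracle q e =>
    have hγ : substGate (realifyCompiler G) k (QGate.oracle q e) =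
        [QGate.oracle (G := realifyGateSet G) q (e.trans (Fin.castAddEmb (realifyCompiler G).scratch))] := rfl
    rw [hγ, QCircuit.toMatrix_cons, QCircuit.toMatrix_nil, Matrix.one_mul]
    change placeGate (e.trans Fin.castSuccEmb) (oracleGate A q) *ᵥ reVec ψ =
      reVec (placeGate e (oracleGate A q) *ᵥ ψ)
    rw [← reOp_placeGate_of_isRealMatrix e (isRealMatrix_oracleGate A q), reOp_mulVec_reVec]

/-- **The substituted (realified) circuit acts on realified states as the realification of the
original circuit.** [cite: BernsteinVazirani1997, §8] -/
theorem toMatrix_substCircuit_mulVec_reVec (A : Language Bool) (k : ℕ) (C : QCircuit G N) (ψ : QReg N → ℂ) :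
    (substCircuit (realifyCompiler G) k C).toMatrix A *ᵥ reVec ψ = reVec (C.toMatrix A *ᵥ ψ) := by
  obtain ⟨gs⟩ := C
  induction gs generalizing ψ with
  | nil =>
    have h : substCircuit (realifyCompiler G) k (⟨[]⟩ : QCircuit G N) = ⟨[]⟩ := rfl
    rw [h, QCircuit.toMatrix_nil, QCircuit.toMatrix_nil, Matrix.one_mulVec, Matrix.one_mulVec]
  | cons γ gs ih =>
    have hsplit : (substCircuit (realifyCompiler G) k (⟨γ :: gs⟩ : QCircuit G N)).toMatrix A =
        (substCircuit (realifyCompiler G) k (⟨gs⟩ : QCircuit G N)).toMatrix A *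
          (⟨substGate (realifyCompiler G) k γ⟩ :
            QCircuit (realifyGateSet G) (N + (realifyCompiler G).scratch)).toMatrix A := by
      change ((⟨(γ :: gs).flatMap (substGate (realifyCompiler G) k)⟩ :
        QCircuit (realifyGateSet G) (N + (realifyCompiler G).scratch))).toMatrix A = _
      rw [List.flatMap_cons]
      exact QCircuit.toMatrix_append A
        (⟨substGate (realifyCompiler G) k γ⟩ : QCircuit (realifyGateSet G) (N + (realifyCompiler G).scratch))
        ⟨gs.flatMap (substGate (realifyCompiler G) k)⟩
    rw [hsplit, ← Matrix.mulVec_mulVec, toMatrix_substGate_mulVec_reVec, ih, Matrix.mulVec_mulVec,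
      ← QCircuit.toMatrix_cons]

end Semantics

/-! ### Acceptance probabilities are unchanged -/

section Accept

variable {G : QGateSet} {n m : ℕ}

/-- The padded input of the enlarged register, read through `assocEmb`, is the padded input with
flag `false`. [folklore] -/
theorem padInput_succ_comp_assocEmb (x : QReg n) (m : ℕ) :
    padInput x (m + 1) ∘ assocEmb n m 1 = (Fin.snoc (padInput x m) false : QReg (n + m + 1)) := by
  funext j
  rw [Function.comp_apply]
  induction j using Fin.lastCases with
  | last =>
    rw [Fin.snoc_last, padInput_apply_of_le x (m + 1) _ (by simp)]
  | cast j =>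
    rw [Fin.snoc_castSucc]
    by_cases hj : (j : ℕ) < n
    · rw [padInput_apply_of_lt x m j hj, padInput_apply_of_lt x (m + 1) _ (by simpa using hj)]
      congr 1
    · rw [padInput_apply_of_le x m j (by omega), padInput_apply_of_le x (m + 1) _ (by simp; omega)]

/-- On the empty register there are no gates when every gate acts on at least one wire. [folklore] -/
theorem gates_eq_nil_of_arity_pos (hpos : ∀ g, 0 < G.arity g) (C : QCircuit G 0) : C.gates = [] := by
  obtain ⟨gs⟩ := C
  cases gs with
  | nil => rfl
  | cons γ _ =>
    exfalso
    cases γ with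
    | gate g e => exact Fin.elim0 (e ⟨0, hpos g⟩)
    | oracle q e => exact Fin.elim0 (e 0)

/-- **The realified circuit of a family has the acceptance probabilities of the original circuit**
(the input `|x 0ᵐ 0⟩` is real, the output is `(Re φ ; Im φ)` for the original output `φ`, and
`|Re φ_y|² + |Im φ_y|² = |φ_y|²`; on the empty register both sides vanish when all gates act on at
least one wire). [cite: AdlemanDeMarraisHuangSICOMP1997, §2 (p. 1525)] -/
theorem acceptProb_realify (hpos : ∀ g, 0 < G.arity g) (A : Language Bool) (k : ℕ) (C : QCircuit G (n + m))
    (x : QReg n) :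
    (mapWires (assocEmb n m 1) (substCircuit (realifyCompiler G) k C)).acceptProb A x = C.acceptProb A x := by
  classical
  have h1 : 0 < n + (m + 1) := by omega
  have h2 : 0 < n + m + 1 := by omega
  have hsurj : ∀ i, i ∈ Set.range (assocEmb n m 1) := fun i => by
    obtain ⟨j, hj⟩ := (finCongr (Nat.add_assoc n m 1)).surjective i
    exact ⟨j, hj⟩
  have hφ' : ∀ y : QReg (n + m + 1),
      QCircuit.toMatrix (n := n + m + 1) A (substCircuit (realifyCompiler G) k C) y (Fin.snoc (padInput x m) false) =
        reVec (C.toMatrix A *ᵥ basisState (padInput x m)) y := fun y => by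
    have h := congrFun (toMatrix_substCircuit_mulVec_reVec A k C (basisState (padInput x m))) y
    rw [reVec_basisState] at h
    have h' := congrFun (mulVec_basisState
      (QCircuit.toMatrix (n := n + m + 1) A (substCircuit (realifyCompiler G) k C)) (Fin.snoc (padInput x m) false)) y
    rw [← h, ← h']
    rfl
  -- the new acceptance probability, as a sum over the register `QReg (n + m + 1)`
  have hnew : (mapWires (assocEmb n m 1) (substCircuit (realifyCompiler G) k C)).acceptProb A x =
      ∑ y : QReg (n + m + 1), if y ⟨0, h2⟩ = true then
        ‖reVec (C.toMatrix A *ᵥ basisState (padInput x m)) y‖ ^ 2 else 0 := by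
    unfold QCircuit.acceptProb
    simp only [dif_pos h1, QCircuit.runOn, toMatrix_mapWires, placeGate_mulVec_basisState_apply,
      padInput_succ_comp_assocEmb]
    refine Fintype.sum_bijective (fun y : QReg (n + (m + 1)) => y ∘ assocEmb n m 1)
      ⟨fun y y' h => by
          funext i
          obtain ⟨j, rfl⟩ := hsurj i
          exact congrFun h j,
        fun y' => ⟨y' ∘ (finCongr (Nat.add_assoc n m 1)).symm, funext fun j =>
          congrArg y' ((finCongr (Nat.add_assoc n m 1)).symm_apply_apply j)⟩⟩ _ _ (fun y => ?_)
    have h0 : y ⟨0, h1⟩ = (y ∘ assocEmb n m 1) ⟨0, h2⟩ := congrArg y (Fin.ext (by simp))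
    rw [h0, if_pos (fun i hi => absurd (hsurj i) hi), hφ']
  rw [hnew]
  by_cases h' : 0 < n + m
  · -- the flag wire is not wire `0`: Born weights of `(Re φ ; Im φ)` read off the original wires
    unfold QCircuit.acceptProb
    simp only [dif_pos h', QCircuit.runOn]
    convert sum_ite_norm_sq_reVec (C.toMatrix A *ᵥ basisState (padInput x m))
      (fun z' : QReg (n + m) => z' ⟨0, h'⟩ = true) using 3
    exact Iff.rfl
  · -- the empty register: no gates, both sides vanish
    have hn : n = 0 := by omega
    have hm : m = 0 := by omega
    subst hn
    subst hm
    have hgates : C.gates = [] := gates_eq_nil_of_arity_pos hpos C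
    have hC : C = ⟨[]⟩ := QCircuit.ext hgates
    have hφ1 : C.toMatrix A *ᵥ basisState (padInput x 0) = basisState (padInput x 0) := by
      rw [hC, QCircuit.toMatrix_nil, Matrix.one_mulVec]
    unfold QCircuit.acceptProb
    simp only [dif_neg h', Finset.sum_const_zero]
    refine Finset.sum_eq_zero fun y _ => ?_
    by_cases hy : y ⟨0, h2⟩ = true
    · have hne : y ≠ Fin.snoc (padInput x 0) false := by
        intro hyw
        have hlast : (⟨0, h2⟩ : Fin (0 + 0 + 1)) = Fin.last (0 + 0) := Fin.ext rfl
        have := congrFun hyw (Fin.last (0 + 0))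
        rw [Fin.snoc_last, ← hlast, hy] at this
        exact Bool.noConfusion this
      rw [if_pos hy, hφ1, reVec_basisState]
      simp [basisState_apply, hne]
    · rw [if_neg hy]

/-- **Realified families have the acceptance probabilities of the original family.**
[cite: AdlemanDeMarraisHuangSICOMP1997, §2 (p. 1525)] -/
theorem acceptProbOn_realifyFamily (hpos : ∀ g, 0 < G.arity g) (F : QCircuitFamily G) (A : Language Bool)
    (t : ℕ) (x : List Bool) :
    (substFamily (realifyCompiler G) t F).acceptProbOn A x = F.acceptProbOn A x :=
  acceptProb_realify hpos A _ (F.circ x.length) x.get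

end Accept

/-! ### Classes -/

section Classes

variable (G : QGateSet) [Finite G.Op] [Encodable G.Op]

/-- **Realification does not shrink `BQP`-type classes**: every language decided with error `ε` by a
polynomial-time uniform family over `G` is decided with the same error by a polynomial-time uniform
family over the REAL gate set `realifyGateSet G` (one extra wire; same acceptance probabilities;
uniformity by uniform substitution along the constant-word compiler). Hypothesis: every gate of `G`
acts on at least one wire. [cite: AdlemanDeMarraisHuangSICOMP1997, §2 (p. 1525)] -/
theorem BQPWith_subset_BQPWith_realify (hpos : ∀ g, 0 < G.arity g) (ε : ℝ) :
    BQPWith G ε ⊆ BQPWith (realifyGateSet G) ε := by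
  rintro L ⟨F, hF, hU, hL⟩
  refine ⟨substFamily (realifyCompiler G) 0 F,
    isOracleFree_substFamily _ (realifyCompiler_isOracleFree G) 0 hF,
    GateCompiler.isUniform_substFamily (realifyCompiler G) (realifyCompiler_polyTime G) 0 hU, fun x => ?_⟩
  rw [acceptProbOn_realifyFamily hpos]
  exact hL x

/-- In particular `BQPOver G ⊆ BQPOver (realifyGateSet G)`. [cite: AdlemanDeMarraisHuangSICOMP1997, §2 (p. 1525)] -/
theorem BQPOver_subset_BQPOver_realify (hpos : ∀ g, 0 < G.arity g) :
    BQPOver G ⊆ BQPOver (realifyGateSet G) :=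
  BQPWith_subset_BQPWith_realify G hpos (1 / 3)

end Classes

end Literature.Computability.QuantumComplexity

end
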